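import Literature.Computability.AlgebraicComplexity.FSV18SparseTrdegOfPerron
import Literature.Computability.AlgebraicComplexity.FSV18Lemma40Proofs
import HarnessLib

/-!
# FSV 2018 Thm. 9 from FOUR external facts (Lemma 40 discharged) — resp. THREE + sharp Perron

M. A. Forbes, A. Shpilka, B. L. Volk, *Succinct hitting sets and barriers to proving lower bounds
for algebraic circuits*, ToC 14 (2018) = arXiv:1701.05328 [ForbesShpilkaVolk2018], Thm. 9
(= ToC Thm. 1.10). The assembly `FSV2018_thm9_of_fiveFacts` (`FSV18Thm9AssemblyL36`) takes five
printed external results as hypotheses; Lemma 40 [FSS14, Thm. 28 / STOC Thm. 4.1] is now a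
theorem (`FSV2018_lemma40_holds`, `FSV18Lemma40Proofs`), so four remain: Fact 19 [SS],
Lemma 23 [BMS13/ASSS16], Thm. 48 [ASSS16], Lemma 53 (∀ F) — the last one reduced to the sharp
Perron theorem by `ForbesShpilkaVolk2018_lemma53_of_perron` (`FSV18SparseTrdegOfPerron`), and a
theorem outright in characteristic `0` (`ForbesShpilkaVolk2018_lemma53_of_charZero`; Thm. 9
quantifies over all fields at once, so the char-`0` discharge does not shorten the list by itself).
Join file: neither import imports the other. Honest framing: sorry-free glue between typed facts;
`VP ≠ VNP` is not proved and nothing here is progress on it.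
-/

namespace Literature.Computability.AlgebraicComplexity

open Literature.RingTheory.Nullstellensatz

/-- **FSV Thm. 9 (ToC Thm. 1.10) from four external facts** — `FSV2018_thm9_of_fiveFacts` with
its Lemma-40 hypothesis discharged by `FSV2018_lemma40_holds` [FSS14, Thm. 28].
[cite: ForbesShpilkaVolk2018, Thm. 9 (seq.) = ToC Thm. 1.10, pp. 14–15; Lemma 40 = ToC Lemma 5.16] -/
theorem FSV2018_thm9_of_fourFacts (h19 : FSV2018_fact19) (h23 : FSV2018_lemma23)
    (h48 : FSV2018_thm48) (h53 : ∀ (F : Type) [Field F], ForbesShpilkaVolk2018_lemma53 F) :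
    FSV2018_thm9 :=
  FSV2018_thm9_of_fiveFacts h19 h23 FSV2018_lemma40_holds h48 h53

/-- **FSV Thm. 9 (ToC Thm. 1.10) from THREE printed external results and the sharp Perron
theorem:** Fact 19 [SS], Lemma 23 [BMS13/ASSS16], Thm. 48 [ASSS16]; Lemma 40 is the theorem
`FSV2018_lemma40_holds`, Lemma 53 (∀ F) comes from `perronTheorem_sharp`
[BMS13 Thm. 4 = Płoski 2005 Thm. 1.1] via `ForbesShpilkaVolk2018_lemma53_of_perron`.
[cite: ForbesShpilkaVolk2018, Thm. 9 (seq.) = ToC Thm. 1.10, pp. 14–15; BeeckenMittmannSaxena2013, Thm. 4] -/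
theorem FSV2018_thm9_of_threeFacts_of_perron (h19 : FSV2018_fact19) (h23 : FSV2018_lemma23)
    (h48 : FSV2018_thm48) (hP : perronTheorem_sharp) : FSV2018_thm9 :=
  FSV2018_thm9_of_fourFacts_of_perron h19 h23 FSV2018_lemma40_holds h48 hP

end Literature.Computability.AlgebraicComplexity
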